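import Mathlib.MeasureTheory.Integral.Layercake
import Mathlib.Topology.Algebra.Group.Pointwise
import Mathlib.Topology.Order.Compact
import Literature.Analysis.Convexity.BrunnMinkowski
import HarnessLib

/-!
# The anisotropic isoperimetric inequality, I: sup-convolution and Brunn–Minkowski

Topic `Literature/Analysis/Convexity`; first file of the series proving the anisotropic
isoperimetric (Wulff) inequality for the distributional `K`-perimeter in `ℝⁿ`
(`AnisotropicIsoperimetric*.lean`), on top of the tree's Brunn–Minkowski inequality
(`BrunnMinkowski.lean`, proved from Prékopa–Leindler).

This file is the convex-geometry step (Gardner 2002, §5: "the isoperimetric inequality follows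
from Brunn–Minkowski", eq. (13)–(14), run for a FUNCTION instead of a set). For a continuous
`u : ℝⁿ → [0, ∞)` and a nonempty compact `K ⊆ ℝⁿ` put `U(x) = sup_{z ∈ K} u(x − z)` (the
sup-convolution of `u` by `K`). Its superlevel sets are the Minkowski sums
`{U > t} = {u > t} + K`, so Brunn–Minkowski (homogeneous form, two binomial terms kept) gives
`vol{U > t} ≥ vol{u > t} + n · vol(K)^{1/n} · vol{u > t}^{(n-1)/n}` for every `t` when `n ≥ 2`
(`volume_add_binomial_le_volume_add`), and the layer-cake formula integrates this to
`∫ U ≥ ∫ u + n · vol(K)^{1/n} · ∫_0^∞ vol{u > t}^{(n-1)/n} dt`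
(`lintegral_add_le_lintegral_supConv`). The later files bound `∫ U − ∫ u` from ABOVE by
`ε · (K-total variation of u) + O(ε²)` when `K` is replaced by `εK` and `u` is a mollified
indicator, which yields the Wulff inequality.

Everything is in `ℝ≥0∞` (Lebesgue integrals), for Lebesgue measure `volume` on
`EuclideanSpace ℝ (Fin n)`; no definition is introduced (the sup-convolution is written out as
`sSup ((fun z => u (x - z)) '' K)`).

## References
* R. J. Gardner, *The Brunn–Minkowski inequality*, Bull. AMS 39 (2002), §5, (13)–(14).
  [`Gardner2002`]
-/

noncomputable section

open Set Filter
open _root_.MeasureTheory _root_.MeasureTheory.Measure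
open scoped ENNReal NNReal Pointwise Topology

namespace Literature.Analysis.Convexity

variable {n : ℕ}

/-! ### Two binomial terms -/

/-- `x^k + k x^{k-1} y ≤ (x + y)^k` in `ℝ≥0∞` for `k ≥ 1` (the first two terms of the binomial
expansion). [folklore] -/
private theorem pow_add_mul_pow_le_add_pow (x y : ℝ≥0∞) {k : ℕ} (hk : k ≠ 0) :
    x ^ k + (k : ℝ≥0∞) * x ^ (k - 1) * y ≤ (x + y) ^ k := by
  obtain ⟨m, rfl⟩ : ∃ m, k = m + 1 := ⟨k - 1, by omega⟩
  rw [Nat.add_sub_cancel]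
  induction m with
  | zero => simp
  | succ m ih =>
    calc x ^ (m + 1 + 1) + ((m + 1 + 1 : ℕ) : ℝ≥0∞) * x ^ (m + 1) * y
        ≤ (x ^ (m + 1) + ((m + 1 : ℕ) : ℝ≥0∞) * x ^ m * y) * (x + y) := by
          push_cast
          have h : x ^ (m + 1 + 1) + (↑m + 1 + 1 : ℝ≥0∞) * x ^ (m + 1) * y
              ≤ x ^ (m + 1 + 1) + (↑m + 1 + 1 : ℝ≥0∞) * x ^ (m + 1) * y
                + (↑m + 1 : ℝ≥0∞) * x ^ m * y * y := le_self_add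
          refine h.trans (le_of_eq ?_)
          ring
      _ ≤ (x + y) ^ (m + 1) * (x + y) := by gcongr; exact ih (by omega)
      _ = (x + y) ^ (m + 1 + 1) := by ring

/-! ### Brunn–Minkowski with two binomial terms -/

/-- **Brunn–Minkowski, two-term form** (`n ≥ 2`): for a measurable `A ⊆ ℝⁿ` and a nonempty compact
`K` with `A + K` measurable, `vol A + n · vol(K)^{1/n} · (vol(A)^{1/n})^{n-1} ≤ vol(A + K)` —
expand `(vol(A)^{1/n} + vol(K)^{1/n})ⁿ ≤ vol(A + K)` and keep two terms (for `A = ∅` both extra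
terms vanish since `n - 1 ≥ 1`). [cite: Gardner2002, Thm 4.1 and §5 (13)–(14)] -/
theorem volume_add_binomial_le_volume_add (hn : 2 ≤ n) {A K : Set (EuclideanSpace ℝ (Fin n))}
    (hA : MeasurableSet A) (hK : IsCompact K) (hKne : K.Nonempty)
    (hAK : MeasurableSet (A + K)) :
    volume A + (n : ℝ≥0∞) * volume K ^ (n⁻¹ : ℝ) * (volume A ^ (n⁻¹ : ℝ)) ^ (n - 1)
      ≤ volume (A + K) := by
  have hn0 : n ≠ 0 := by omega
  have hn1 : n - 1 ≠ 0 := by omega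
  have hpos : (0 : ℝ) < (n⁻¹ : ℝ) := by positivity
  rcases A.eq_empty_or_nonempty with rfl | hAne
  · rw [measure_empty, ENNReal.zero_rpow_of_pos hpos, zero_pow hn1, mul_zero, zero_add]
    exact bot_le
  have hBM := brunnMinkowski hn0 hA hK.measurableSet hAK hAne hKne
  -- raise to the `n`-th power
  have hpow : (volume A ^ (n⁻¹ : ℝ) + volume K ^ (n⁻¹ : ℝ)) ^ n ≤ volume (A + K) := by
    calc _ ≤ (volume (A + K) ^ (n⁻¹ : ℝ)) ^ n := by gcongr
      _ = volume (A + K) := ENNReal.rpow_inv_natCast_pow hn0 _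
  refine le_trans ?_ hpow
  have hbin := pow_add_mul_pow_le_add_pow (volume A ^ (n⁻¹ : ℝ)) (volume K ^ (n⁻¹ : ℝ)) hn0
  rw [ENNReal.rpow_inv_natCast_pow hn0] at hbin
  refine le_trans (le_of_eq ?_) hbin
  ring

/-! ### The sup-convolution: superlevel sets and measurability -/

/-- The sup over a nonempty compact set of translates of a continuous function is attained:
`sSup {u(x - z) : z ∈ K} = u(x - z₀)` for some `z₀ ∈ K` (the sup-convolution `U = sup_K u(· - z)`
of the outer-parallel-body argument, taken for a function). [cite: Gardner2002, §5 (13)] -/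
theorem exists_mem_eq_sSup_image_sub {X : Type*} [TopologicalSpace X] [AddGroup X]
    [ContinuousSub X] {K : Set X} (hK : IsCompact K) (hKne : K.Nonempty) {u : X → ℝ}
    (hu : Continuous u) (x : X) :
    ∃ z ∈ K, sSup ((fun z => u (x - z)) '' K) = u (x - z) := by
  have hc : Continuous fun z => u (x - z) := hu.comp (continuous_const.sub continuous_id)
  obtain ⟨z, hz, hmax⟩ := hK.exists_isMaxOn hKne hc.continuousOn
  refine ⟨z, hz, le_antisymm ?_ ?_⟩
  · exact csSup_le (hKne.image _) (by rintro _ ⟨w, hw, rfl⟩; exact hmax hw)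
  · exact le_csSup ((hK.image hc).bddAbove) (mem_image_of_mem _ hz)

/-- Superlevel sets of the sup-convolution are Minkowski sums:
`{x : t < sup_{z ∈ K} u(x - z)} = {t < u} + K`. [cite: Gardner2002, §5 (13)] -/
theorem setOf_lt_sSup_image_sub_eq_add {X : Type*} [TopologicalSpace X] [AddCommGroup X]
    [ContinuousSub X] {K : Set X} (hK : IsCompact K) (hKne : K.Nonempty) {u : X → ℝ}
    (hu : Continuous u) (t : ℝ) :
    {x | t < sSup ((fun z => u (x - z)) '' K)} = {x | t < u x} + K := by
  ext x
  simp only [mem_setOf_eq]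
  constructor
  · intro hx
    obtain ⟨z, hz, hzeq⟩ := exists_mem_eq_sSup_image_sub hK hKne hu x
    rw [hzeq] at hx
    exact ⟨x - z, hx, z, hz, sub_add_cancel x z⟩
  · rintro ⟨a, ha, z, hz, rfl⟩
    have hc : Continuous fun w => u (a + z - w) := hu.comp (continuous_const.sub continuous_id)
    refine lt_of_lt_of_le ?_ (le_csSup ((hK.image hc).bddAbove) (mem_image_of_mem _ hz))
    simpa using ha

/-- The sup-convolution of a continuous function by a nonempty compact set is (Borel)
measurable (its superlevel sets `{t < u} + K` are open). [cite: Gardner2002, §5 (13)] -/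
theorem measurable_sSup_image_sub {K : Set (EuclideanSpace ℝ (Fin n))} (hK : IsCompact K)
    (hKne : K.Nonempty) {u : EuclideanSpace ℝ (Fin n) → ℝ} (hu : Continuous u) :
    Measurable fun x => sSup ((fun z => u (x - z)) '' K) := by
  refine measurable_of_Ioi fun t => ?_
  have : (fun x => sSup ((fun z => u (x - z)) '' K)) ⁻¹' Ioi t
      = {x | t < u x} + K := by
    rw [← setOf_lt_sSup_image_sub_eq_add hK hKne hu t]; rfl
  rw [this]
  exact ((isOpen_lt continuous_const hu).add_right).measurableSet

/-- Each translate is below the sup-convolution: `u(x - z) ≤ sup_{z' ∈ K} u(x - z')` for `z ∈ K`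
(so `U ≥ u` when `0 ∈ K`, the inclusion `A ⊆ A + K` of the parallel-body argument).
[cite: Gardner2002, §5 (13)] -/
theorem le_sSup_image_sub_of_mem {X : Type*} [TopologicalSpace X] [AddGroup X]
    [ContinuousSub X] {K : Set X} (hK : IsCompact K) {u : X → ℝ} (hu : Continuous u)
    {z : X} (hz : z ∈ K) (x : X) : u (x - z) ≤ sSup ((fun z => u (x - z)) '' K) :=
  le_csSup ((hK.image (hu.comp (continuous_const.sub continuous_id))).bddAbove)
    (mem_image_of_mem _ hz)

/-! ### Integration: the layer-cake formula -/

/-- **Sup-convolution gains at least the Brunn–Minkowski surface term** (`n ≥ 2`): for a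
continuous `u ≥ 0` on `ℝⁿ` and a nonempty compact `K`,
`∫ u + n · vol(K)^{1/n} · ∫_0^∞ (vol{u > t}^{1/n})^{n-1} dt ≤ ∫ sup_{z ∈ K} u(· - z)`
(Lebesgue integrals; layer-cake representation of both integrals and the two-term
Brunn–Minkowski inequality on every superlevel set). [cite: Gardner2002, §5 (13)–(14)] -/
theorem lintegral_add_le_lintegral_supConv (hn : 2 ≤ n) {K : Set (EuclideanSpace ℝ (Fin n))}
    (hK : IsCompact K) (hKne : K.Nonempty) {u : EuclideanSpace ℝ (Fin n) → ℝ}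
    (hu : Continuous u) (hu0 : ∀ x, 0 ≤ u x) :
    (∫⁻ x, ENNReal.ofReal (u x)) +
        (n : ℝ≥0∞) * volume K ^ (n⁻¹ : ℝ) *
          ∫⁻ t in Ioi (0 : ℝ), (volume {x | t < u x} ^ (n⁻¹ : ℝ)) ^ (n - 1)
      ≤ ∫⁻ x, ENNReal.ofReal (sSup ((fun z => u (x - z)) '' K)) := by
  obtain ⟨z₀, hz₀⟩ := hKne
  have hU0 : ∀ x, 0 ≤ sSup ((fun z => u (x - z)) '' K) := fun x =>
    (hu0 _).trans (le_sSup_image_sub_of_mem hK hu hz₀ x)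
  have hUm := measurable_sSup_image_sub hK ⟨z₀, hz₀⟩ hu
  rw [lintegral_eq_lintegral_meas_lt volume (Eventually.of_forall hu0) hu.measurable.aemeasurable,
    lintegral_eq_lintegral_meas_lt volume (Eventually.of_forall hU0) hUm.aemeasurable]
  have hmeas : Measurable fun t : ℝ => volume {x | t < u x} := by
    refine Antitone.measurable fun s t hst => measure_mono fun x (hx : t < u x) => ?_
    exact lt_of_le_of_lt hst hx
  rw [← lintegral_const_mul _ ((hmeas.pow_const _).pow_const _), ← lintegral_add_left hmeas]
  refine lintegral_mono fun t => ?_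
  rw [setOf_lt_sSup_image_sub_eq_add hK ⟨z₀, hz₀⟩ hu t]
  have hA : IsOpen {x | t < u x} := isOpen_lt continuous_const hu
  exact volume_add_binomial_le_volume_add hn hA.measurableSet hK ⟨z₀, hz₀⟩
    hA.add_right.measurableSet

end Literature.Analysis.Convexity

end
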